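import Mathlib.Tactic.Linarith
import Mathlib.Tactic.Ring
import Mathlib.Tactic.NormNum
import Mathlib.Tactic.Abel
import Mathlib.LinearAlgebra.FiniteDimensional.Basic
import Mathlib.LinearAlgebra.FiniteDimensional.Lemmas
import Mathlib.LinearAlgebra.Dual.Lemmas
import HarnessLib

/-!
# The (0,1) cell of the ι-window, EXISTENCE side, XXIV: the NODAL QUADRISECANT — skeleton of `H2-EXISTENCE-SIDE-24.md` (prover 3 gen 31)

Family `hodge`, b2b cell `hweil`, `Summits/HodgeConjecture/HodgeConjecture/Theorems` (helper of item stmt-HodgeConjecture-2524). New topic, new file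
(the lineage's `WeilTypeLadderH2Quadrisecant.lean` is at 348/400 lines).

Setting and notation as in [XVI]–[XXIII]: `(A, Θ)` a general ppav fourfold (`NS = ℤθ`, `Θ` smooth, symmetric), `γ = θ³/6`, `κ : A → |2Θ| = ℙ¹⁵` the
Kummer map, `Λ_a = H⁰(𝓘_{S_a}(2Θ))` (dimension 5), `ℙ(Λ_a) = 𝕋_{κ(a)}Kum(A)`, `S_a = Θ_a ∩ Θ_{−a}`, `B(a,a′) = [Λ_a | Λ_{a′}]` (16 × 10),
`kdim = dim (Λ_a ∩ Λ_{a′}) = 10 − rank B`, the bitangent locus `M`, its second type `M-II` (`kdim = 2`, [XXIII]). NEW in [XXIV]: a general ppav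
fourfold is also, in a 1-parameter family of ways, the Prym variety of a double cover `C̃ → C` of a genus-4 curve RAMIFIED at two points `R₁, R₂`
(Frediani–Naranjo–Spelta 2021), with nodal Abel–Prym curve `Z_n = ψ(C̃)`, `ψ(x) = [x] = x − σx`, node `ψ(R₁) = ψ(R₂) = 0`, branch directions
`b₁ ≠ b₂`; and for such Pryms FAY'S QUADRISECANT IDENTITY holds (Fay 1989, 'Schottky relations on ½(C − C)', Proc. Sympos. Pure Math. 49;
Taimanov, Russian Math. Surveys 52 (1997) §6.3.1 / (211)): for every quadruple `p₁,…,p₄ ∈ C̃` the Kummer points `κ(½(p₁+p₂+p₃+p₄))`,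
`κ(½(p₁+p₂−p₃−p₄))`, `κ(½(p₁+p₃−p₂−p₄))`, `κ(½(p₁+p₄−p₂−p₃))` are COPLANAR. The report specialises `p₄ = R₁` (`[p₄] = 0`), `[p₁] = u`,
`[p₂] = w`, `[p₃] = 2e`: the four points become `κ(a ± e), κ(a′ ± e)` with `2a = u + w`, `a′ = a − u`; letting `p₃ → R_i` the two secants become
the tangent lines at `κ(a)`, `κ(a′)` in the branch direction `b_i`, which therefore MEET (`E_i`); `E₁ ≠ E₂`; hence `kdim(a,a′) ≥ 2`, `rank B ≤ 8`
(THEOREM FH = the '⊇' half of [XXIII]'s CONJECTURE M2), and the theta-incidence behind Fay's formula gives NODAL BD1: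
`Θ ∩ Θ_u ∩ Θ_{−w} ⊂ T_{Z_n} ∪ Θ_{u−w}` and `S_a ∩ S_{a′} = a′ + (Θ ∩ Θ_u ∩ Θ_{−w} ∩ Θ_{u−w})`.
HONEST FRAMING: this file records the LINEAR-ALGEBRA steps (genuinely: two lines in a plane meet; two distinct points span a line; `5 + 5 − 2 = 8`;
the `E₁ ≠ E₂` syllogism) and the ADDITIVE BOOKKEEPING of the argument; the geometric content (Pryms, theta functions, Fay's identity, limits of
secants) is NOT kernel-checked; census results about one cell of the ladder's H2 test on the existence side; no case of the Hodge conjecture is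
proved; nothing here is a rung; no statement of [Markman 2025] is used. 0 unconditional rungs above the floor.
-/

set_option linter.dupNamespace false

namespace Summit.HodgeConjecture.HodgeConjecture.WeilTypeLadder

section H2NodalQuadrisecantXXIV

open Module

/-- FAY'S FOUR HALF-POINTS WITH A RAMIFICATION BASE POINT (report 2.3). In the additive group of `A` (no halving needed: everything doubled):
with `[p₄] = 0` (a ramification point), `[p₁] = u`, `[p₂] = w`, `[p₃] = e + e` and `a + a = u + w`, `a′ = a − u`, the four Fay arguments
doubled, `p₁+p₂+p₃+p₄`, `p₁+p₂−p₃−p₄`, `p₁+p₃−p₂−p₄`, `p₁+p₄−p₂−p₃`, equal `(a+e)+(a+e)`, `(a−e)+(a−e)`, `(e−a′)+(e−a′)`, `(−a′−e)+(−a′−e)`: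
the four Kummer points are `κ(a+e), κ(a−e), κ(a′−e), κ(a′+e)` (`κ` is even). Also `a + a′ = w`, `a′ + a′ = w − u`, `u − w = −(a′ + a′)`. -/
theorem fay_ramified_halfpoints {G : Type*} [AddCommGroup G] (u w e a a' : G) (ha : a + a = u + w) (ha' : a' = a - u) :
    (u + w + (e + e) + 0 = (a + e) + (a + e)) ∧ (u + w - (e + e) - 0 = (a - e) + (a - e)) ∧
    (u + (e + e) - w - 0 = (e - a') + (e - a')) ∧ (u + 0 - w - (e + e) = (-a' - e) + (-a' - e)) ∧
    (a + a' = w) ∧ (a' + a' = w - u) ∧ (u - w = -(a' + a')) ∧ (a - a' = u) := by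
  subst ha'
  refine ⟨?_, ?_, ?_, ?_, ?_, ?_, ?_, ?_⟩
  · rw [← ha]; abel
  · rw [← ha]; abel
  · have : u - w = (u + w) - (w + w) := by abel
    have h2 : e - (a - u) + (e - (a - u)) = (e + e) + (u + u) - (a + a) := by abel
    rw [h2, ha]; abel
  · have h2 : -(a - u) - e + (-(a - u) - e) = (u + u) - (a + a) - (e + e) := by abel
    rw [h2, ha]; abel
  · have h2 : a + (a - u) = (a + a) - u := by abel
    rw [h2, ha]; abel
  · have h2 : a - u + (a - u) = (a + a) - (u + u) := by abel
    rw [h2, ha]; abel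
  · have h2 : -(a - u + (a - u)) = (u + u) - (a + a) := by abel
    rw [h2, ha]; abel
  · abel

/-- THE DEGENERATE PAIRS EXCLUDED IN THEOREM FH (report 3.1, hypotheses). With `a + a = u + w`, `a′ = a − u` (so `a′ + a′ = w − u`):
`a′ = a ↔ u = 0`; `a′ = −a ↔ w = 0`; `a + a = 0 ↔ w = −u`; `a′ + a′ = 0 ↔ w = u`. So for `u, w ∈ Z_n ∖ {0}` with `w ≠ ±u` the points `a, a′`
are not 2-torsion and `a′ ≠ ±a` — the open conditions under which `κ` is an immersion at `a, a′`, `S_{a′}` is an integral surface and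
`κ(a) ∉ 𝕋_{a′}`. -/
theorem nodal_halfpair_nondegenerate {G : Type*} [AddCommGroup G] (u w a a' : G) (ha : a + a = u + w) (ha' : a' = a - u) :
    (a' = a ↔ u = 0) ∧ (a' = -a ↔ w = 0) ∧ (a + a = 0 ↔ w = -u) ∧ (a' + a' = 0 ↔ w = u) := by
  subst ha'
  have hw : a - u + a = w := by
    have h3 : a - u + a = (a + a) - u := by abel
    rw [h3, ha]; abel
  have hwu : a - u + (a - u) = w - u := by
    have h3 : a - u + (a - u) = (a + a) - (u + u) := by abel
    rw [h3, ha]; abel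
  refine ⟨sub_eq_self, ?_, ?_, ?_⟩
  · rw [eq_neg_iff_add_eq_zero, hw]
  · rw [ha, add_comm, add_eq_zero_iff_eq_neg]
  · rw [hwu, sub_eq_zero]

/-- THE SHARED CURVE OF A NODAL HALF-PAIR IS A TRANSLATE OF A FOURFOLD THETA-INTERSECTION (report 4.2, COR FH2 (a)): for ANY `a, a′` with
`u = a − a′`, `w = a + a′`: `x + a′ ∈ Θ_{a′} ∩ Θ_a ∩ Θ_{−a} ∩ Θ_{−a′}` iff `x ∈ Θ_0 ∩ Θ_u ∩ Θ_{−w} ∩ Θ_{u−w}`, because the four translation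
parameters agree: `a′ − a′ = 0`, `a − a′ = u`, `−a − a′ = −w`, `−a′ − a′ = u − w`. Hence `S_a ∩ S_{a′} = a′ + (Θ ∩ Θ_u ∩ Θ_{−w} ∩ Θ_{u−w})`
EXACTLY, and NODAL BD1 (`Θ ∩ Θ_u ∩ Θ_{−w} ⊂ T_{Z_n} ∪ Θ_{u−w}`) puts the residual `R + a′` inside `S_a ∩ S_{a′}`. Recorded: the four
identities in any additive commutative group. -/
theorem nodal_halfpair_translates {G : Type*} [AddCommGroup G] (a a' : G) :
    let u := a - a'; let w := a + a'
    (a' - a' = 0) ∧ (a - a' = u) ∧ (-a - a' = -w) ∧ (-a' - a' = u - w) := by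
  dsimp only
  refine ⟨by abel, rfl, by abel, by abel⟩

/-- TWO LINES IN A PLANE MEET (report 3.2, the limit lemma's linear-algebra step). Projective lines = 2-dimensional subspaces `L, L′` of
`V = H⁰(2Θ)^∨` (any vector space over a division ring); if both lie in a subspace `Π` of dimension ≤ 3 (Fay: the four Kummer points
`κ(a ± e), κ(a′ ± e)` are coplanar, and `L = ⟨κ(a+e), κ(a−e)⟩`, `L′ = ⟨κ(a′+e), κ(a′−e)⟩`), then `L ∩ L′ ≠ 0`: the two secants MEET,
for every `e` with `2e ∈ Z_n`. -/
theorem secants_in_quadrisecant_plane_meet {K V : Type*} [DivisionRing K] [AddCommGroup V] [Module K V] [FiniteDimensional K V]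
    (L L' P : Submodule K V) (hL : finrank K L = 2) (hL' : finrank K L' = 2) (hP : finrank K P ≤ 3) (h1 : L ≤ P) (h2 : L' ≤ P) :
    1 ≤ finrank K ↥(L ⊓ L') := by
  have hsup : finrank K ↥(L ⊔ L') ≤ 3 := (Submodule.finrank_mono (sup_le h1 h2)).trans hP
  have key := Submodule.finrank_sup_add_finrank_inf_eq L L'
  rw [hL, hL'] at key
  omega

/-- TWO DISTINCT COMMON POINTS GIVE `kdim ≥ 2` (report 3.3). If `E₁ ≠ E₂` are points (1-dimensional subspaces) of `ℙ(Λ_a ∩ Λ_{a′})`, then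
`dim (Λ_a ∩ Λ_{a′}) ≥ 2`: a space of dimension ≤ 1 containing a line IS that line, so it cannot contain two distinct ones. -/
theorem two_points_force_kdim_two {K V : Type*} [DivisionRing K] [AddCommGroup V] [Module K V] [FiniteDimensional K V]
    (E₁ E₂ W : Submodule K V) (h1 : finrank K E₁ = 1) (h2 : finrank K E₂ = 1) (hne : E₁ ≠ E₂) (le1 : E₁ ≤ W) (le2 : E₂ ≤ W) :
    2 ≤ finrank K W := by
  by_contra hlt
  have hW1 : finrank K W ≤ 1 := by omega
  have e1 : E₁ = W := Submodule.eq_of_le_of_finrank_le le1 (by rw [h1]; exact hW1)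
  have e2 : E₂ = W := Submodule.eq_of_le_of_finrank_le le2 (by rw [h2]; exact hW1)
  exact hne (e1.trans e2.symm)

/-- `kdim ≥ 2` MEANS `rank B(a,a′) ≤ 8` (report 3.3): `rank [Λ_a | Λ_{a′}] = dim (Λ_a + Λ_{a′}) = 5 + 5 − dim (Λ_a ∩ Λ_{a′})`. -/
theorem kdim_two_rank_le_eight {K V : Type*} [DivisionRing K] [AddCommGroup V] [Module K V] [FiniteDimensional K V]
    (La La' : Submodule K V) (ha : finrank K La = 5) (ha' : finrank K La' = 5) (hk : 2 ≤ finrank K ↥(La ⊓ La')) :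
    finrank K ↥(La ⊔ La') ≤ 8 := by
  have key := Submodule.finrank_sup_add_finrank_inf_eq La La'
  rw [ha, ha'] at key
  omega

/-- `E₁ ≠ E₂` (report 3.3, the syllogism). `ℓ₁, ℓ₂` = the tangent lines at `κ(a)` in the two branch directions `b₁ ≠ b₂` (2-dimensional
subspaces meeting exactly in the point `⟨κ(a)⟩ =: P₀`, because `dκ_a` is injective off `A[2]`); `E_i ⊂ ℓ_i` the common points with the
tangent lines at `κ(a′)`, both inside `T′ = Λ_{a′}`; and `κ(a) ∉ 𝕋_{a′}`, i.e. `P₀ ∩ T′ = 0` (for `a ≠ ±a′`: `S_{a′}` is integral and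
`H⁰(𝓘_{S_{a′}}(Θ_x)) = 0` for `x ≠ ±a′`). Then `E₁ ≠ E₂`: otherwise `E₁ ⊂ ℓ₁ ∩ ℓ₂ = P₀`, so `E₁ = P₀ ⊂ T′`, contradiction. -/
theorem branch_points_distinct {K V : Type*} [DivisionRing K] [AddCommGroup V] [Module K V] [FiniteDimensional K V]
    (ℓ₁ ℓ₂ P₀ T' E₁ E₂ : Submodule K V) (hmeet : ℓ₁ ⊓ ℓ₂ = P₀) (hP : finrank K P₀ = 1) (hPT : P₀ ⊓ T' = ⊥)
    (hE1 : finrank K E₁ = 1) (l1 : E₁ ≤ ℓ₁) (l2 : E₂ ≤ ℓ₂) (t1 : E₁ ≤ T') : E₁ ≠ E₂ := by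
  intro heq
  have hE : E₁ ≤ P₀ := by rw [← hmeet]; exact le_inf l1 (heq ▸ l2)
  have hEP : E₁ = P₀ := Submodule.eq_of_le_of_finrank_le hE (by rw [hP, hE1])
  have : P₀ ≤ P₀ ⊓ T' := le_inf le_rfl (hEP ▸ t1)
  rw [hPT, le_bot_iff] at this
  have h0 : finrank K P₀ = 0 := by rw [this, finrank_bot]
  omega

/-- THE BRANCH DIRECTIONS ARE DISTINCT — Riemann–Roch count (report 3.1 (b)). `b_i = ` the image of `R_i` under the Prym-canonical map
`|K_C ⊗ δ|` (`δ² = 𝒪(p₁ + p₂)`, `deg δ = 1`, `g(C) = 4`); `b₁ = b₂` iff `h⁰(K_C δ(−p₁−p₂)) = h⁰(K_C δ⁻¹) ≥ 3`; Riemann–Roch: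
`h⁰(K_C δ⁻¹) − h⁰(δ) = deg(K_C δ⁻¹) − g + 1 = 5 − 4 + 1 = 2`, so this happens iff `h⁰(δ) ≥ 1`, i.e. `δ = 𝒪(x)` with `2x ∼ p₁ + p₂` — a
`g¹₂` unless `p₁ = p₂`; impossible on a non-hyperelliptic curve. Also recorded: `g(C̃) = 8` (Riemann–Hurwitz `2·8 − 2 = 2(2·4 − 2) + 2`),
`dim P = 8 − 4 = 4 = h⁰(K_C ⊗ δ) = 7 − 4 + 1`, `dim ℛ_{4,2} − dim 𝒜₄ = (3·4 − 3 + 2) − 10 = 1` (the 1-parameter family of ramified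
presentations of a general `A`), and `p_a(Z_n) = 8 + 1 = 9`. -/
theorem ramified_presentation_counts :
    (∀ h0 h1 : ℤ, h0 - h1 = (6 - 1) - 4 + 1 → (3 ≤ h0 ↔ 1 ≤ h1)) ∧
    (2 * 8 - 2 = 2 * (2 * 4 - 2) + 2) ∧ (8 - 4 = 4) ∧ ((6 + 1) - 4 + 1 = 4) ∧ ((3 * 4 - 3 + 2) - 10 = 1) ∧ (8 + 1 = 9) := by
  refine ⟨fun h0 h1 h => ?_, by norm_num, by norm_num, by norm_num, by norm_num, by norm_num⟩
  omega

/-- DIMENSION BOOKKEEPING OF THE NODAL HALF-PAIR FAMILY (report 3.4). `(Z_n; u, w) ↦ (a, a′) = (½(u+w), ½(w−u))` is finite-to-one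
(`u = a − a′`, `w = a + a′` recover the pair), so the nodal half-pairs form a subvariety of `{rank B ≤ 8}` of dimension `1 + 2 = 3`,
whereas the expected dimension of `{rank B ≤ 8}` in the 8-dimensional `(a, a′)`-space is `8 − (16 − 8)(10 − 8) = −8 < 0` and that of
`{rank B ≤ 9} ⊇ M` is `8 − (16 − 9)(10 − 9) = 1` ([XVI] 4.4): both families found ([XXII] `M_Z`, dimension `2 + 2 = 4`; [XXIV] the nodal
half-pairs, dimension 3) exceed the expected dimensions by 3 and by 11. -/
theorem nodal_halfpair_dimension_count :
    (1 + 2 = 3) ∧ ((8 : ℤ) - (16 - 8) * (10 - 8) = -8) ∧ ((8 : ℤ) - (16 - 9) * (10 - 9) = 1) ∧ (2 + 2 = 4) ∧ (4 - 1 = 3) ∧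
    ((3 : ℤ) - (-8) = 11) := by
  refine ⟨by norm_num, by norm_num, by norm_num, by norm_num, by norm_num, by norm_num⟩

/-- NODAL BD1, the set-theoretic step (report 4.1 (c)): if `X ⊂ Θ_v ∪ Y` for EVERY `v ∈ Z_n` (Fay–Taimanov incidence with a ramification
base point, closed up in `v`), then `X ⊂ (⋂_{v ∈ Z_n} Θ_v) ∪ Y`, and `⋂_{v ∈ Z_n} Θ_v = {x : Z_n ⊂ Θ_x} = T_{Z_n} =: Z*` (`Θ` symmetric:
`x − v ∈ Θ ↔ v − x ∈ Θ ↔ v ∈ Θ_x`). Recorded: the pure set-theoretic implication, for an arbitrary family of sets. -/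
theorem incidence_for_all_translates {α ι : Type*} (X Y : Set α) (T : ι → Set α) (h : ∀ i, X ⊆ T i ∪ Y) :
    X ⊆ (⋂ i, T i) ∪ Y := by
  intro x hx
  by_cases hy : x ∈ Y
  · exact Or.inr hy
  · left
    simp only [Set.mem_iInter]
    intro i
    rcases h i hx with h1 | h2
    · exact h1
    · exact absurd h2 hy

/-- CLASS BOOKKEEPING OF NODAL BD1 (report 4.3, conditional on multiplicity one — measured, not proved): `[Θ·Θ_u·Θ_{−w}] = θ³ = 6γ`,
`[Z*] = 2γ` (a theta-dual of Abel–Prym type), so the residual `R` has class `6γ − 2γ = 4γ` and `θ`-degree `4·4 = 16` (`θ·γ = 4`), genus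
`8·4 − 11 = 21` by [XXIII] COR D's formula at `k = 4`; `c(S_a, S_{a′}) = θ·(R + a′) = 16 ≡ 0 (mod 8)` — the (odd) clause of THEOREM M is
idle on these pairs; the conditions imposed on `|3Θ|, |4Θ|` predicted for class `kγ`, genus `g` by [XXIII] 5.2's `4kn + 1 − g`:
`(28, 44)` for `(k, g) = (4, 21)` (on `|2Θ|` the shared curve is superabundant: `8 = 16 − 8` conditions, not `12`), and `(8, 16, 24)` for
`Z* + a′` (`k = 2`, `g = 9`) — [XXIII]'s measured values (F2), (F3). -/
theorem nodal_bd1_classes :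
    (6 - 2 = 4) ∧ (4 * 4 = 16) ∧ (8 * 4 - 11 = 21) ∧ (16 % 8 = 0) ∧
    (4 * 4 * 3 + 1 - 21 = 28 ∧ 4 * 4 * 4 + 1 - 21 = 44 ∧ 4 * 4 * 2 + 1 - 21 = 12 ∧ 16 - 8 = 8) ∧
    (4 * 2 * 2 + 1 - 9 = 8 ∧ 4 * 2 * 3 + 1 - 9 = 16 ∧ 4 * 2 * 4 + 1 - 9 = 24) := by
  norm_num

end H2NodalQuadrisecantXXIV

section H2NodalQuadrisecantXXIVb

/-!
## ADDENDUM A ([XXIV]-ex §8): THEOREM FH⁼ — kdim = 2 EXACTLY on the nodal half-pairs, by the POLAR MAP.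
A common section `s ∈ Λ_a ∩ Λ_{a′}` is `λ θ_aθ_{−a} + Σ c_i ∂_{a_i}(θ_aθ_{−a})`; its POLAR VECTOR is `v(s) = Σ c_i e_i ∈ T₀A`. Restricted to
`Θ_a`, `s = −θ_{−a}·∂_{v(s)}θ_a`, and `s` vanishes on `Θ_a ∩ S_{a′} ⊇ Z* + a` (PROP NB for the pair `(−u, w)`), so `∇ϑ(t)·v(s) = 0` for every `t ∈ Z*`
off `Θ_{−(u+w)}`: `v(s)` lies in the common kernel `V` of the Gauss images of `Z*`. LEMMA TN: every `Θ_t ⊃ Z_n` is tangent at the node to BOTH branches,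
so `∇ϑ(t) ⊥ b₁, b₂` for all `t ∈ Z*` — the Gauss map of `Θ` sends the theta-dual `Z*` into the LINE `ℙ(N₀^⊥)`; finiteness of the Gauss map makes the
span exactly `N₀^⊥` (2-dimensional), so `V = N₀` (dimension `4 − 2 = 2`); `s ↦ v(s)` is injective on `Λ_a ∩ Λ_{a′}` (its kernel is `ℂ·θ_aθ_{−a}`, and
`θ_aθ_{−a} ∉ Λ_{a′}`); hence `kdim ≤ 2`, and with THEOREM FH `kdim = 2`. Recorded below: the three linear-algebra steps, in full generality.
-/

open Module

/-- THE POLAR MAP BOUNDS kdim (ADDENDUM A, THEOREM FH⁼ (iv)): an injective linear map from `Λ_a ∩ Λ_{a′}` whose image lies in a 2-dimensional space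
(`N₀`, the branch plane) forces `dim (Λ_a ∩ Λ_{a′}) ≤ 2`; with THEOREM FH's `≥ 2`, equality. Any division ring. -/
theorem kdim_le_two_of_injective_polar_map {K V W : Type*} [DivisionRing K] [AddCommGroup V] [Module K V] [AddCommGroup W] [Module K W]
    [FiniteDimensional K W] (f : V →ₗ[K] W) (hf : Function.Injective f) (N : Submodule K W) (hN : finrank K N = 2)
    (hrange : LinearMap.range f ≤ N) : finrank K V ≤ 2 ∧ (2 ≤ finrank K V → finrank K V = 2) := by
  have h1 : finrank K (LinearMap.range f) = finrank K V := LinearMap.finrank_range_of_inj hf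
  have h2 : finrank K (LinearMap.range f) ≤ finrank K N := Submodule.finrank_mono hrange
  refine ⟨by omega, fun h => by omega⟩

/-- LEMMA TN, the linear step (ADDENDUM A, 8.2): a covector (`∇ϑ(t)`, `t ∈ Z*`) that kills both branch vectors `b₁, b₂` of the node kills the whole
branch plane `N₀ = ⟨b₁, b₂⟩` — i.e. the tangent hyperplane `T_tΘ` CONTAINS `N₀`, and the Gauss image of `t` lies on the line `ℙ(N₀^⊥) ⊂ ℙ(T₀^*A)`. -/
theorem gauss_image_kills_branch_plane {K V : Type*} [Field K] [AddCommGroup V] [Module K V] (ℓ : Module.Dual K V) (b₁ b₂ : V)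
    (h1 : ℓ b₁ = 0) (h2 : ℓ b₂ = 0) : ∀ v ∈ Submodule.span K ({b₁, b₂} : Set V), ℓ v = 0 := by
  intro v hv
  obtain ⟨c, d, rfl⟩ := Submodule.mem_span_pair.mp hv
  simp [map_add, map_smul, h1, h2]

/-- THE COMMON KERNEL OF THE GAUSS IMAGES IS THE BRANCH PLANE (ADDENDUM A, 8.3): if the Gauss images `∇ϑ(t)`, `t ∈ Z*`, span a 2-dimensional space
of covectors (`= N₀^⊥`: contained in it by LEMMA TN, equal to it because the Gauss map of the smooth ample `Θ` is finite, so the images of the CURVE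
`Z*` are not a single point), then their common kernel `V = {v : ∇ϑ(t)·v = 0 ∀ t}` has dimension `4 − 2 = 2` (hence `= N₀`). Stated for a
4-dimensional space over any field via the dual coannihilator. -/
theorem gauss_kernel_is_plane {K V : Type*} [Field K] [AddCommGroup V] [Module K V] [FiniteDimensional K V] (hV : finrank K V = 4)
    (W : Subspace K (Module.Dual K V)) (hW : finrank K W = 2) : finrank K W.dualCoannihilator = 2 := by
  have h := Subspace.finrank_add_finrank_dualCoannihilator_eq W
  omega

/-- GENERIC BIDUALITY (ADDENDUM A, 8.4, the dimension step): if a component `Z*_j` of `Z*` lay in `Θ_{u ∓ w}` for ALL `(u, w) ∈ Z_n²`, then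
`Z* ⊇ Z*_j + Z_n`, a surface (`1 + 1 = 2 > 1`) unless `Z*_j` is a translate of an elliptic curve — impossible on a general (simple) `A`; so for
`(u, w)` outside a proper closed subset of the 2-dimensional `Z_n²` no component of `Z*` lies in `Θ_{u−w} ∪ Θ_{u+w}`, and COR FH2's equality
`C′ = R + a′`, `D′ = Z* + a′` and THEOREM FH⁼ hold there. Recorded: the dimension bookkeeping. -/
theorem generic_biduality_dimension_count : (1 + 1 = 2) ∧ (2 > 1) ∧ (1 + 1 - 0 = 2) ∧ (2 - 1 = 1) := by
  norm_num

end H2NodalQuadrisecantXXIVb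

end Summit.HodgeConjecture.HodgeConjecture.WeilTypeLadder
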